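/-
Origin: expansion seat `planner-pub-hodgecm-toy2-g4-0`, handover #5 2026-08-18T08:01:59Z (`HOME/pub-hodgecm-toy2-g4/lean/Toy2g4/Fieldwise.lean`, md5 2c1ceb3f, 152 lines);
landed by the gen-7 packager in gate run 26 as `HodgeCM/Model/Toy/ToyOpenInputsFieldwise.lean` (import ^import Toy2g4\.PadH6Qw8\b→import HodgeCM.Model.Toy.ToyPadH6Qw8 ×1).
-/
/-
Copyright: HODGE-CM cell, CONSISTENCY seat 2 (6a)(ii), generation 4 (unit pub-hodgecm-toy2-g4).  RUN 26.
Package target: `HodgeCM/Model/Toy/ToyOpenInputsFieldwise.lean` (additive leaf; lands after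
`HodgeCM/Model/Toy/ToyPadH6Qw8.lean`).
-/
import Summits.HodgeConjecture.HodgeCM.Model.Toy.ToyPadH6Qw8
import Summits.HodgeConjecture.HodgeCM.Model.Toy.ToyOpenInputs

/-!
# `OpenInputs`, field by field: every one of the four open inputs carries content

`HodgeCM.Universe.OpenInputs` (StubTree/Inputs.lean) records the four inputs in the cone of the headline theorems:
`realisation_perL`, `realisation_face`, `pohlmann_span`, `qw8_sufficiency`.  The consistency lineage (toy, toy2-g2,
toy2-g3, toy2-g4) now has, for EACH field, a structure satisfying all 28 model facts `ModelAxioms`, `W_RK4`, and the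
other [QW8]/Pohlmann inputs that are available, in which that field FAILS:

| field | separating model | what it keeps |
|---|---|---|
| `realisation_perL`, `realisation_face` | `toyModel` (toy; toy2-g2 `ToyOpenInputs`) | `ModelAxioms`, `PohlmannSpan`, `Qw8Sufficiency`, `W_RK4`, `FaceReduction`, `HC_CM` |
| `pohlmann_span` | `padAlgModel` (toy2-g4 `ToyPadH6Alg`) | `ModelAxioms`, `Qw8Sufficiency`, `W_RK4`, `FaceReduction`, `HC_CM` |
| `qw8_sufficiency` | `truncModel` (toy2-g3 `ToyTruncAlg`), `padModel` (toy2-g4 `ToyPadH6Qw8`) | `ModelAxioms`, `PohlmannSpan`, `W_RK4`, `Lemma81` resp. `ModelAxioms`, N2–N4, F4, F5, `W_RK4`, `Lemma81` |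

assembled here as `openInputs_fieldwise_independent`.  So no field of `OpenInputs` is a consequence of the model
facts together with the other inputs listed — each "carries content".  Conversely `pohlmann_span` and
`qw8_sufficiency` are not REFUTABLE from the model facts (`openInputs_fieldwise_consistent`: both hold in `toyModel`);
for the two realisation inputs no positive model exists in the period-free toy family (every top-degree trace vanishes
there, `ToyOpenInputs`) — their joint consistency with `ModelAxioms` is the business of the theta-realisation models of
CONSISTENCY seat 1, not of this file.  `pohlmannSpan_qw8Sufficiency_all_four`: the two [QW8]/Pohlmann inputs are
mutually independent over `ModelAxioms ∧ W_RK4` (all four truth-value combinations occur among `toyModel`, `padAlgModel`,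
`truncModel`, `padModel`).

This file also completes the `FaceReduction` / `Lemma81` rows of `padModel`: `PadH6.not_hc_cmProd` (COR-CM fails in
`U♯` already on `A_Φ` over the Galois CM field of `faceHypothesesInhabited`), hence `PadH6.not_faceReduction` and —
vacuously — `PadH6.lemma81`.

Axioms: `propext`, `Classical.choice`, `Quot.sound` only.
-/

open scoped TensorProduct

namespace HodgeCM

open Literature.AlgebraicGeometry.Motives (CMType)

namespace Universe

variable {U : Universe}

namespace PadH6

set_option smartUnfolding false in
/-- **COR-CM fails in `U♯` on every `A_Φ` over a CM field with at least six embeddings**: `H⁶(A_Φ, ℂ) ≠ 0` (it contains a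
weight line), so some pad vector `(0, v)`, `v ≠ 0`, is a rational Hodge class of `H♯⁶(A_Φ)` that is not algebraic. -/
theorem not_hc_cmProd (M : U.ModelAxioms) (hN1 : U.Fact_cupExterior) {F : CMField} (h6 : 6 ≤ Module.finrank ℚ F)
    (Φ : CMType F) : ¬ U.padH6.HC (U.cmProd F (fun _ : Fin (0 + 1) => Φ)) := by
  intro hHC
  let Θ : Fin (0 + 1) → CMType F := fun _ => Φ
  have hcard : 6 ≤ (Finset.univ : Finset ((F : Type) →+* ℂ)).card := by
    rw [Finset.card_univ, NumberField.Embeddings.card]; exact h6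
  obtain ⟨T, -, hT⟩ := Finset.exists_subset_card_eq hcard
  have hline : Module.finrank ℂ (U.weightSpace F Θ (fun _ => T) 6) = 1 := by
    rw [finrank_weightSpace M hN1 (by norm_num), if_pos]
    simp [hT]
  have hv : ∀ v : U.Coh (U.cmProd F Θ) 6, v = 0 := fun v =>
    (ofPad_mem_alg_iff (U := U) _ v).mp (hHC 3 (ofPad_mem_hodgeClassesOf (U := U) _ v))
  have hz : ∀ z : U.CohC (U.cmProd F Θ) 6, z = 0 := fun z => by
    induction z using TensorProduct.induction_on with
    | zero => rfl
    | tmul c v => rw [hv v, TensorProduct.tmul_zero]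
    | add x y hx hy => rw [hx, hy, add_zero]
  have hpos : 0 < Module.finrank ℂ (U.weightSpace F Θ (fun _ => T) 6) := by rw [hline]; exact Nat.one_pos
  obtain ⟨w, hw⟩ := Module.finrank_pos_iff_exists_ne_zero.mp hpos
  exact hw (Subtype.ext (hz _))

set_option smartUnfolding false in
/-- Hence **`FaceReduction` FAILS in `U♯`** (its face hypothesis is `W_RK4` of `U`; its conclusion COR-CM for `A_Φ` fails). -/
theorem not_faceReduction (M : U.ModelAxioms) (hN1 : U.Fact_cupExterior) (hW : U.W_RK4) : ¬ U.padH6.FaceReduction := by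
  intro h
  obtain ⟨F, hG, h6, f, -, -⟩ := faceHypothesesInhabited
  exact not_hc_cmProd M hN1 h6 f.Φ (h F hG h6 ((w_RK4_iff (U := U)).mpr hW F hG h6) 0 fun _ => f.Φ)

set_option smartUnfolding false in
/-- … and **`Lemma81` HOLDS in `U♯`, vacuously** (its hypothesis asserts COR-CM for every `∏ A_Θ`). -/
theorem lemma81 (M : U.ModelAxioms) (hN1 : U.Fact_cupExterior) : U.padH6.Lemma81 := by
  intro h
  obtain ⟨F, hG, h6, f, -, -⟩ := faceHypothesesInhabited
  exact absurd (h F hG h6 0 fun _ => f.Φ) (not_hc_cmProd M hN1 h6 f.Φ)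

end PadH6

end Universe

namespace Toy

open Universe

/-- (Ported verbatim from the HodgeCMPerL package; no docstring in the source.) -/
theorem not_padModel_faceReduction : ¬ padModel.FaceReduction :=
  PadH6.not_faceReduction toyModel_modelAxioms toyModel_fact_cupExterior toyModel_w_rk4

/-- (Ported verbatim from the HodgeCMPerL package; no docstring in the source.) -/
theorem padModel_lemma81 : padModel.Lemma81 := PadH6.lemma81 toyModel_modelAxioms toyModel_fact_cupExterior

/-- **Every field of `OpenInputs` carries content.**  For each of the four fields there is a model of the 28 model facts
and `W_RK4` — keeping the other [QW8]/Pohlmann inputs shown — in which that field is FALSE. -/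
theorem openInputs_fieldwise_independent :
    (∃ U : Universe, U.ModelAxioms ∧ U.PohlmannSpan ∧ U.Qw8Sufficiency ∧ U.W_RK4 ∧ U.FaceReduction ∧ U.HC_CM ∧
        ¬ U.RealisationExistsPerL) ∧
    (∃ U : Universe, U.ModelAxioms ∧ U.PohlmannSpan ∧ U.Qw8Sufficiency ∧ U.W_RK4 ∧ U.FaceReduction ∧ U.HC_CM ∧
        ¬ U.RealisationExistsFace) ∧
    (∃ U : Universe, U.ModelAxioms ∧ U.Qw8Sufficiency ∧ U.W_RK4 ∧ U.FaceReduction ∧ U.HC_CM ∧ ¬ U.PohlmannSpan) ∧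
    (∃ U : Universe, U.ModelAxioms ∧ U.PohlmannSpan ∧ U.W_RK4 ∧ U.Lemma81 ∧ ¬ U.Qw8Sufficiency) :=
  ⟨⟨toyModel, toyModel_modelAxioms, toyModel_pohlmannSpan', toyModel_qw8Sufficiency, toyModel_w_rk4, toyModel_faceReduction,
      toyModel_hc_cm, toyModel_not_realisationExistsPerL⟩,
    ⟨toyModel, toyModel_modelAxioms, toyModel_pohlmannSpan', toyModel_qw8Sufficiency, toyModel_w_rk4, toyModel_faceReduction,
      toyModel_hc_cm, toyModel_not_realisationExistsFace⟩,
    ⟨padAlgModel, padAlgModel_modelAxioms, padAlgModel_qw8Sufficiency, padAlgModel_w_rk4, padAlgModel_faceReduction,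
      padAlgModel_hc_cm, not_padAlgModel_pohlmannSpan⟩,
    ⟨truncModel, truncModel_modelAxioms, truncModel_pohlmannSpan, truncModel_w_rk4, truncModel_lemma81,
      not_truncModel_qw8Sufficiency⟩⟩

/-- The same for `qw8_sufficiency` with the textbook cup facts kept instead (`padModel`: N2, N3, N4, F4, F5). -/
theorem qw8Sufficiency_not_of_facts :
    ∃ U : Universe, U.ModelAxioms ∧ U.Fact_cup_hodge ∧ U.Fact_pull_H0 ∧ U.Fact_hodge_F0 ∧ U.Fact_cupAlg ∧
      U.Fact_cupAssoc ∧ U.Fact_dimProd ∧ U.W_RK4 ∧ U.Lemma81 ∧ ¬ U.Qw8Sufficiency :=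
  ⟨padModel, padModel_modelAxioms, padModel_fact_cup_hodge, padModel_fact_pull_H0, padModel_fact_hodge_F0,
    padModel_fact_cupAlg, padModel_fact_cupAssoc, padModel_fact_dimProd, padModel_w_rk4, padModel_lemma81,
    not_padModel_qw8Sufficiency⟩

/-- **… and no field is refutable from the model facts**: `pohlmann_span` and `qw8_sufficiency` HOLD in `toyModel`
(together with `W_RK4`, `FaceReduction`, `HC_CM`).  (For the realisation inputs the period-free toy family cannot
provide a positive model: every top-degree trace vanishes there, `ToyOpenInputs`.) -/
theorem openInputs_fieldwise_consistent :
    ∃ U : Universe, U.ModelAxioms ∧ U.PohlmannSpan ∧ U.Qw8Sufficiency ∧ U.W_RK4 ∧ U.FaceReduction ∧ U.HC_CM :=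
  ⟨toyModel, toyModel_modelAxioms, toyModel_pohlmannSpan', toyModel_qw8Sufficiency, toyModel_w_rk4, toyModel_faceReduction,
    toyModel_hc_cm⟩

/-- Corollary: **the two [QW8]/Pohlmann inputs are mutually independent over `ModelAxioms ∧ W_RK4`** — all four
truth-value combinations occur (`toyModel` ✓✓, `padAlgModel` ✗✓, `truncModel` ✓✗, `padModel` ✗✗). -/
theorem pohlmannSpan_qw8Sufficiency_all_four :
    ∃ U₁ U₂ U₃ U₄ : Universe,
      (U₁.ModelAxioms ∧ U₁.W_RK4 ∧ U₁.PohlmannSpan ∧ U₁.Qw8Sufficiency) ∧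
      (U₂.ModelAxioms ∧ U₂.W_RK4 ∧ ¬ U₂.PohlmannSpan ∧ U₂.Qw8Sufficiency) ∧
      (U₃.ModelAxioms ∧ U₃.W_RK4 ∧ U₃.PohlmannSpan ∧ ¬ U₃.Qw8Sufficiency) ∧
      (U₄.ModelAxioms ∧ U₄.W_RK4 ∧ ¬ U₄.PohlmannSpan ∧ ¬ U₄.Qw8Sufficiency) :=
  ⟨toyModel, padAlgModel, truncModel, padModel,
    ⟨toyModel_modelAxioms, toyModel_w_rk4, toyModel_pohlmannSpan', toyModel_qw8Sufficiency⟩,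
    ⟨padAlgModel_modelAxioms, padAlgModel_w_rk4, not_padAlgModel_pohlmannSpan, padAlgModel_qw8Sufficiency⟩,
    ⟨truncModel_modelAxioms, truncModel_w_rk4, truncModel_pohlmannSpan, not_truncModel_qw8Sufficiency⟩,
    ⟨padModel_modelAxioms, padModel_w_rk4, not_padModel_pohlmannSpan, not_padModel_qw8Sufficiency⟩⟩

end Toy

end HodgeCM
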